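import Summits.KontsevichZagierPeriods.KontsevichZagierPeriods.Theses.UnfoldedStokes
import Summits.KontsevichZagierPeriods.KontsevichZagierPeriods.Theorems.UnfoldedStokesUnfoldedStokesSquareStubs

/-!
# Route KontsevichZagierPeriods/UnfoldedStokes — crux `UnfoldedStokesSquare`, part 3/3: assembly (closes stmt-KontsevichZagierPeriods-3520)

Problem `KontsevichZagierPeriods`, route `UnfoldedStokes`, item stmt-KontsevichZagierPeriods-3520
(`UnfoldedStokesSquare`, crux, rank 2): the unfolded Stokes relator of the unit square lies in
`KZ.relations`.  Data: `U ⊇ [0,1]²` open and star-shaped about `0`; `a, b, c, e` of class `C¹` and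
`ℚ`-semialgebraic on `U` (with the five first partials that occur also semialgebraic), the 1-form
`ω = a ds + b dt` closed (`∂ₜa = ∂ₛb`).  With `Ω(s,t,u) = s·a(us,ut) + t·b(us,ut)` the combination
`[rB] + [rR] − [rT] − [rL] − [rW] − [rD]` of the four edge representations, the wedge representation
`rW = [D, ae − bc]` and the bulk representation `rD = [D×(0,1), Ω·(∂ₛe − ∂ₜc)]` is a KZ relation.

Line `divergence-engine-transport` (crux idea card of the same name; skeleton `SketchIdeator1.lean`
of the crux work directory, landed against the route declaration BY NAME): the crux is ONE
instance (`k = 2`) of the move-level divergence theorem on the open cube already proved in the tree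
for crux `DihedralNormalForm` of route `LinRedNormalForm`
(`TameBVStokes.stub_boundedStokesMove`, its bounded-variation hypothesis discharged by
`TameBVStokes.stub_bvStokes`; both sorry-free `Theorems` files), applied to the HOMOTOPY VECTOR FIELD
`G = (Ω·e, −Ω·c, −(u·a(up)·e − u·b(up)·c))` on `(0,1)³`: its flux through the six faces is
`rR, rL, −rT, −rB, −rW, 0` and its divergence is `rD`'s integrand `Ω·(∂ₛe − ∂ₜc)` — the closedness
`∂ₜa = ∂ₛb` enters ONLY through this pointwise identity, via the Literature lemmas
`KZ.UnfoldedStokesData.hasDerivAt_unfolding_insertNth` (closedness unfolded: `∂ⱼΩ = ∂ᵤ(u·aⱼ(up))`)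
and `KZ.UnfoldedStokesData.hasDerivAt_mul_a_smul` (the radial derivative).

The proof is split by topic over three files:
* `UnfoldedStokesUnfoldedStokesSquareField`  — §0 the engine (`divergenceEngine` =
  `stub_boundedStokesMove stub_bvStokes`) and its literal-index form in dimension 3
  (`divergenceEngine₃`); §1 the field (`dil`, `proj`, `Omega`, `fieldS/T/U`) and polynomial-map
  facts; S1 `stub_fieldSemialgebraic` (composition with polynomial maps into the star-shaped `U`);
  §3 the six face identities;
* `UnfoldedStokesUnfoldedStokesSquareStubs`  — S2 `stub_fieldRegular` (bounded / differentiable /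
  fibre-continuous) and S3 `stub_fieldDiv` (the divergence identity, where closedness acts);
* `UnfoldedStokesUnfoldedStokesSquare`       — §4 the assembly (engine + `[r] + [r.neg] ∈ relations`,
  `[0] ∈ relations`, `abel`): `unfoldedStokesSquare_proof : …Theses.UnfoldedStokes.UnfoldedStokesSquare`.

Sources: M. Kontsevich, D. Zagier, *Periods* (2001), §1.2 (the Stokes rule); R. Bott, L. Tu,
*Differential Forms in Algebraic Topology* (1982), §4 (homotopy operator of the Poincaré lemma);
P. Griffiths, J. Harris, *Principles of Algebraic Geometry* (1978), Ch. 0 (Stokes on a cell).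
-/

noncomputable section

open MeasureTheory Set
open Literature.NumberTheory.Transcendental
open Literature.ModelTheory.ExponentialFields (IsSemialgebraic)

namespace Summit.KontsevichZagierPeriods.UnfoldedStokes.UnfoldedStokesSquare

/-! ## 4. Assembly: the crux from the engine and the three stubs -/

/-- **The crux** `UnfoldedStokes.UnfoldedStokesSquare` (item stmt-KontsevichZagierPeriods-3520), from the
engine `divergenceEngine₃` and the stubs S1–S3: the type is the route declaration itself, unfolded as
the first step. -/
theorem unfoldedStokesSquare_proof :
    Summit.KontsevichZagierPeriods.KontsevichZagierPeriods.Theses.UnfoldedStokes.UnfoldedStokesSquare := by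
  unfold Summit.KontsevichZagierPeriods.KontsevichZagierPeriods.Theses.UnfoldedStokes.UnfoldedStokesSquare
  intro U a b c e hU hUI hstar ha hb hc he hclosed sa sb sc se sa₀ sa₁ sb₁ sc₁ se₀ rB rR rT rL rW rD
    hBd hBi hRd hRi hTd hTi hLd hLi hWd hWi hDd hDi
  -- the zero representation on the open square (face `u = 0`)
  obtain ⟨Z, hZd, hZi⟩ := KZ.exists_zeroRep (KZ.isSemialgebraic_unitCube 2)
  obtain ⟨⟨C, hCS, hCT, hCU⟩, ⟨hdS, hdT, hdU⟩, ⟨hcS, hcT, hcU⟩⟩ :=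
    stub_fieldRegular U a b c e hU hUI hstar ha hb hc he
  obtain ⟨hsS, hsT, hsU⟩ := stub_fieldSemialgebraic U a b c e hUI hstar sa sb sc se
  have hdiv := stub_fieldDiv U a b c e hU hUI hstar ha hb hc he hclosed sa sb sc se sa₀ sa₁ sb₁ sc₁ se₀
  -- the engine, with faces `f₁ = (rR, −rT, −rW)`, `f₀ = (rL, −rB, 0)` and `r = rD`
  have key := divergenceEngine₃ (fieldS a b e) (fieldT a b c) (fieldU a b c e) C rD
    rL rB.neg Z rR rT.neg rW.neg hsS hsT hsU hCS hCT hCU hdS hdT hdU hcS hcT hcU hDd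
    (fun x hx => by rw [hDi hx]; exact (hdiv x (by rw [hDd] at hx; exact hx)).symm)
    hLd (by rw [KZ.IntegralRep.domain_neg, hBd]) hZd hRd (by rw [KZ.IntegralRep.domain_neg, hTd])
    (by rw [KZ.IntegralRep.domain_neg, hWd])
    (fun y hy => by
      show rL.integrand y = fieldS a b e (Fin.insertNth 0 0 y)
      rw [hLi (show y ∈ rL.domain by rw [hLd]; exact hy), fieldS_zero])
    (fun y hy => by
      show rR.integrand y = fieldS a b e (Fin.insertNth 0 1 y)
      rw [hRi (show y ∈ rR.domain by rw [hRd]; exact hy), fieldS_one])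
    (fun y hy => by
      show rB.neg.integrand y = fieldT a b c (Fin.insertNth 1 0 y)
      rw [KZ.IntegralRep.integrand_neg, Pi.neg_apply, hBi (show y ∈ rB.domain by rw [hBd]; exact hy),
        fieldT_zero])
    (fun y hy => by
      show rT.neg.integrand y = fieldT a b c (Fin.insertNth 1 1 y)
      rw [KZ.IntegralRep.integrand_neg, Pi.neg_apply, hTi (show y ∈ rT.domain by rw [hTd]; exact hy),
        fieldT_one])
    (fun y hy => by
      show Z.integrand y = fieldU a b c e (Fin.insertNth 2 0 y)
      rw [hZi, Pi.zero_apply, fieldU_zero])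
    (fun y hy => by
      show rW.neg.integrand y = fieldU a b c e (Fin.insertNth 2 1 y)
      rw [KZ.IntegralRep.integrand_neg, Pi.neg_apply, hWi (show y ∈ rW.domain by rw [hWd]; exact hy),
        fieldU_one])
  -- the sign bookkeeping: `[r] + [r.neg] ∈ relations`, `[Z] ∈ relations`
  have hB : KZ.of rB + KZ.of rB.neg ∈ KZ.relations :=
    KZ.of_add_of_mem_relations_of_eqOn_neg rfl fun x _ => rfl
  have hT : KZ.of rT + KZ.of rT.neg ∈ KZ.relations :=
    KZ.of_add_of_mem_relations_of_eqOn_neg rfl fun x _ => rfl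
  have hW : KZ.of rW + KZ.of rW.neg ∈ KZ.relations :=
    KZ.of_add_of_mem_relations_of_eqOn_neg rfl fun x _ => rfl
  have hZ : KZ.of Z ∈ KZ.relations := KZ.of_mem_relations_of_eqOn_zero Z (by rw [hZi]; exact fun _ _ => rfl)
  have : KZ.of rB + KZ.of rR - KZ.of rT - KZ.of rL - KZ.of rW - KZ.of rD =
      -(KZ.of rD - (KZ.of rR - KZ.of rL + (KZ.of rT.neg - KZ.of rB.neg) + (KZ.of rW.neg - KZ.of Z))) +
        (KZ.of rB + KZ.of rB.neg) - (KZ.of rT + KZ.of rT.neg) - (KZ.of rW + KZ.of rW.neg) + KZ.of Z := by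
    abel
  rw [this]
  exact KZ.relations.add_mem (KZ.relations.sub_mem (KZ.relations.sub_mem
    (KZ.relations.add_mem (KZ.relations.neg_mem key) hB) hT) hW) hZ

end Summit.KontsevichZagierPeriods.UnfoldedStokes.UnfoldedStokesSquare

end
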